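import Summits.QuantumFields.YangMills.Theorems.BalabanUVNodesN06Eq3132FromStateKnitQ
import Summits.QuantumFields.YangMills.Theorems.BalabanUVNodesN06Eq3132CoerciveFromGAKnitQJ
import Summits.QuantumFields.YangMills.Theorems.BalabanUVNodesN06Eq3132DecayFromMajorantKnitQJ
import Summits.QuantumFields.YangMills.Theorems.BalabanUVNodesN06Eq3132CoerciveVariationalQJ
import Literature.MathematicalPhysics.QuantumFieldTheory.Balaban1983to89.B9Eq3132FromStateRJ
import Literature.MathematicalPhysics.QuantumFieldTheory.Balaban1983to89.B9Eq3132NuReadingRJ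

/-!
# BalabanUVNodes ∕ N06 ([B9], `Dag.B9_main`) — R1 J-TWIN: ROW 26 (`B9.Stmt3132Printed`) FOR THE `ν`-READINGS OF `(Q G_D Q⋆)⁻¹ ∕ (Q G₁ Q⋆)⁻¹` AT PRINT's KNIT AVERAGING
# FROM THE SECT.-D STATE TUPLE, ROW 17 AND A TEST FAMILY, ALONG A SUB-FAMILY `f : J → MemberY …` — the J-twin of ✓`…N06Eq3132FromStateKnitQ` (this seat g37,
# P-Q26-knit piece 5; read by dag-n06-d's KD‴ as `s3132_nu_knit_of_stepS_R`)

Sources as in the parent's header ([B9] (3.132), Thm 3.12, Thm 3.11, (3.115), (3.35)–(3.36); [4] (2.142) (2.147) (2.149) (2.60)–(2.61); [5] (139)–(147)).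

WHY (cell `pub-ymgap`, node N06, bundle F7 rows 20–21, seat dag-n06-l g41).  IR-N06-SECTION-2 road **R1** («J-twin of the producer cone», ★★★ director-ym №524 (3):
authorised in principle, STAGED, sibling files only, by-name asks), `R1-JTWIN-SPEC.md` rule (R)′ (taint-only) + (R).3′; dag-n06-d g30 WORD I.23529 (a) («yours, incl.
n06-i's `majorants4_of_stepS_R` along `f`»).  R1 ORDER: after ✓`…Eq3132CoerciveVariationalQJ`, ✓`…Eq3132CoerciveFromGAKnitQJ`, ✓`…Eq3132DecayFromMajorantKnitQJ`,
✓`Lit/B9Eq3132NuReadingRJ` and `Lit/B9Eq3132FromStateRJ`; consumer to come: dag-n06-d's KD‴ᴶ.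

WHAT CHANGES vs the parent (everything else VERBATIM): `{J : Type} (f : J → MemberY θ.d₆ θ.ℓ₆ θ.hd' θ.hL' θ.b₀ θ.b₁ Mstar)` added to the shared variable block after `H₀`;
* TAINTED ROWS: the section variable ROW 17 `hΔ` (= the head's `hΔAK`) and each theorem's state tuple `hstate` (⟸ the state layer ⟸ (3.49) `h49` ⟸ (3.48) `h348`):
  `∀ x : MemberY … ↦ ∀ j : J`, read at `f j`;
* LEFT member-wide: every letter ∕ pin ∕ law ∕ numeric (`𝔬 H₀ T T₁ T₀ Δ hT₀ 𝔮 𝔮s h𝔮 h𝔮s hadj hRP hKpl bI hblk hGco hG1co hG0co hlev hβ1 hnbr 𝔖 hgeo`) and the SECTION-FREE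
  test family `Tt hTt` (laws ∕ pins ∕ numerics only);
* callees → their twins: `B9Eq3132FromStateRJ.majorants4_of_stepS_R_J … H₀ f …`, `…DecayFromMajorantKnitQJ.…_R_J (f := f)`, `…CoerciveVariationalQJ.hcoA_of_testFamily_QR_J (f := f)`,
  `…CoerciveFromGAKnitQJ.…_R_J (f := f)`, `B9Eq3132NuReadingRJ.stmt3132Printed_nu_of_coercive_decay_R_J … (f := f)`;
* conclusions at `I := J` (rule (R).3): `DecayUnder ∕ CoerciveUnder c35 (fun j => geoComap (geo9Y (f j)) Prod.fst) (fun j => bg9YR … (f j)) …` ×2 each, and ★★★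
  `B9.Stmt3132Printed (θ.d₆+1) c35 (fun j => geo9Y (f j)) (fun j => bg9YR … (f j)) (fun j => siteKernelOfOpNu (f j).toKIdx … (Ring.inverse (QGQOfQY (f j).toKIdx … (T (f j)) U))) …`.
PROOF: the parent's text by generator (`lean/g41/gen/mkJ.py`, config `cfg16.json`: `var_tainted`, `jbody` ×2, call redirections); nothing re-derived.  The member-wide
parent is the instance `J := MemberY …`, `f := id`.  ORPHAN by design until KD‴ᴶ lands.
HONEST LABEL: composition of landed theorems re-indexed; Sect.-D state, `hΔ`, `hadj`, the test family, the regime bridge and numerics are HYPOTHESES; nothing of [B9] ∕ [4]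
asserted; COUNT-NEUTRAL (`--supports stmt-QuantumFields-27239 --as helper`); N06 NOT discharged; under R1 the inner-corner question stays DISPLAYED at the K1 face ∕ NODE O
join by (α5); nothing continuum ∕ OS ∕ mass gap ∕ Clay.  0 `def`, 0 `sorry`.  NEW file; the parent untouched.
-/

noncomputable section

namespace Summit.QuantumFields.YangMills.BalabanUVNodes.N06Eq3132FromStateKnitQJ

open scoped Matrix.Norms.L2Operator
open Literature.MathematicalPhysics.QuantumFieldTheory.Balaban1983to89
open Literature.MathematicalPhysics.QuantumFieldTheory.Balaban1983to89.Node00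
open Literature.MathematicalPhysics.QuantumFieldTheory.Balaban1983to89.B6RandomWalk (HasMajorant)
open Literature.MathematicalPhysics.QuantumFieldTheory.Balaban1983to89.B11SectG (HasMaj BlockNorm)
open Literature.MathematicalPhysics.QuantumFieldTheory.Balaban1983to89.B9Thm34Ext (toB6)
open Literature.MathematicalPhysics.QuantumFieldTheory.Balaban1983to89.B6Ineq2142KLevelV1 (lvl β)
open Literature.MathematicalPhysics.QuantumFieldTheory.Balaban1983to89.B6GlobalChartV1 (blkV1)
open Literature.MathematicalPhysics.QuantumFieldTheory.Balaban1983to89.B6KLevelCensusIndexV1 (KIdx kGeo)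
open Literature.MathematicalPhysics.QuantumFieldTheory.Balaban1983to89.B9Thm312Whole (Ops Identities GeoOK cNorm)
open Literature.MathematicalPhysics.QuantumFieldTheory.Balaban1983to89.B9Thm312WholeClasses (cNormR)
open Literature.MathematicalPhysics.QuantumFieldTheory.Balaban1983to89.B9Thm312WholeStepRegular (StepS)
open Literature.MathematicalPhysics.QuantumFieldTheory.Balaban1983to89.B9PinMembersKLevelV1 (MemberY geo9Y)
open Literature.MathematicalPhysics.QuantumFieldTheory.Balaban1983to89.B9BackgroundsKLevelV1R (RegFamY bg9YR)
open Literature.MathematicalPhysics.QuantumFieldTheory.Balaban1983to89.B7Prop2SpecialUnitary (specialUnitaryUnits specialUnitaryUnits_le_unitaryUnits)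
open Literature.MathematicalPhysics.QuantumFieldTheory.Balaban1983to89.B9CoReadingCoords (XBK blkBK GcoK)
open Literature.MathematicalPhysics.QuantumFieldTheory.Balaban1983to89.B9CoReadingCoordsTranspose (TrIdx trBasis)
open Literature.MathematicalPhysics.QuantumFieldTheory.Balaban1983to89.B9Thm311ReadingCoords (trIP PosDefTr IsSymmTr IsAdjTr)
open Literature.MathematicalPhysics.QuantumFieldTheory.Balaban1983to89.B9RWSumsReadsNbr (nbr)
open Literature.MathematicalPhysics.QuantumFieldTheory.Balaban1983to89.B9Eq3132RingInverseReading (normMatY)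
open Literature.MathematicalPhysics.QuantumFieldTheory.Balaban1983to89.B9Eq3132NuReading (lamInvY nuY siteKernelOfOpNu)
open Literature.MathematicalPhysics.QuantumFieldTheory.Balaban1983to89.B9Eq3132NuReadingR (stmt3132Printed_nu_of_coercive_decay_R)
open Literature.MathematicalPhysics.QuantumFieldTheory.Balaban1983to89.B9Eq3132CTInputs (CoerciveUnder DecayUnder)
open Literature.MathematicalPhysics.QuantumFieldTheory.Balaban1983to89.B9Eq3132ScalarIndex (geoComap)
open Literature.MathematicalPhysics.QuantumFieldTheory.Balaban1983to89.B9Eq3132FromStateR (majorants4_of_stepS_R)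
open Literature.MathematicalPhysics.QuantumFieldTheory.Balaban1983to89.Node00.OpsYQLetter (QLetterY QsLetterY adjTrY)
open Literature.MathematicalPhysics.QuantumFieldTheory.Balaban1983to89.B9Eq316AveragingTransposeZd (alphaQ)
open Literature.MathematicalPhysics.QuantumFieldTheory.Balaban1983to89.B9Eq3115KnitLetterY (QknitY)
open Literature.MathematicalPhysics.QuantumFieldTheory.Balaban1983to89.B9C2FormBoxRegimeY (Kpl)
open Literature.MathematicalPhysics.QuantumFieldTheory.Balaban1983to89.B9BackgroundsKLevelV1P (bg9KP)
open Summit.QuantumFields.YangMills.BalabanUVNodes.N06Eq3132DecayFromMajorantKnitQ (decayUnder_QGQOfQY_knit_of_majorants_R)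
open Summit.QuantumFields.YangMills.BalabanUVNodes.N06Eq3132CoerciveFromGAKnitQ (coerciveUnder_of_subMajorants_knit_R)
open Summit.QuantumFields.YangMills.BalabanUVNodes.N06Eq3132CoerciveVariationalQ (hcoA_of_testFamily_QR)

section Faces

variable {κ : Type} [Fintype κ] [DecidableEq κ] {N : ℕ} [Nonempty (Fin N)]
variable (θ : Stage3Params) (Mstar : ℕ) (R₁ R₂ : RegFamY θ.d₆ θ.ℓ₆ θ.hd' θ.hL' θ.b₀ θ.b₁ Mstar (Matrix (Fin N) (Fin N) ℂ))
  [∀ x : MemberY θ.d₆ θ.ℓ₆ θ.hd' θ.hL' θ.b₀ θ.b₁ Mstar, Fintype (geo9Y x).Site] [∀ x : MemberY θ.d₆ θ.ℓ₆ θ.hd' θ.hL' θ.b₀ θ.b₁ Mstar, DecidableEq (geo9Y x).Site]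
  {Y Z W : MemberY θ.d₆ θ.ℓ₆ θ.hd' θ.hL' θ.b₀ θ.b₁ Mstar → Type} [∀ x, Fintype (Z x)] [∀ x, Fintype (W x)]
  (bK : Module.Basis κ ℝ (Matrix (Fin N) (Fin N) ℂ)) {c35 : ℝ}
  (𝔬 : ∀ x : MemberY θ.d₆ θ.ℓ₆ θ.hd' θ.hL' θ.b₀ θ.b₁ Mstar, Ops (geo9Y x) (bg9YR (Matrix (Fin N) (Fin N) ℂ) (specialUnitaryUnits (Fin N)) R₁ R₂ x) (XBK κ x.toKIdx) (Y x) (Z x) (W x))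
  (H₀ : MemberY θ.d₆ θ.ℓ₆ θ.hd' θ.hL' θ.b₀ θ.b₁ Mstar → Prop) {J : Type} (f : J → MemberY θ.d₆ θ.ℓ₆ θ.hd' θ.hL' θ.b₀ θ.b₁ Mstar)
  -- the Sect.-D propagator letters `T = G_D(U)`, `T₁ = G₁(U)` (ANY) and `T₀ = G_A^Q(U) = (Δ_a^Q(U))⁻¹`
  (T T₁ T₀ : ∀ x : MemberY θ.d₆ θ.ℓ₆ θ.hd' θ.hL' θ.b₀ θ.b₁ Mstar, BondOpY (Matrix (Fin N) (Fin N) ℂ) x.toKIdx)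
  (Δ : ∀ x : MemberY θ.d₆ θ.ℓ₆ θ.hd' θ.hL' θ.b₀ θ.b₁ Mstar, CfgY (Matrix (Fin N) (Fin N) ℂ) x.toKIdx →
    ((FBondY x.toKIdx → Matrix (Fin N) (Fin N) ℂ) →ₗ[ℂ] (FBondY x.toKIdx → Matrix (Fin N) (Fin N) ℂ)))
  (hT₀ : ∀ (x : MemberY θ.d₆ θ.ℓ₆ θ.hd' θ.hL' θ.b₀ θ.b₁ Mstar) (U : CfgY (Matrix (Fin N) (Fin N) ℂ) x.toKIdx), T₀ x U = Ring.inverse (Δ x U))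
  -- print's knit averaging pair (pinned by `rfl` at def-Y's `qKnitOfRecord ∕ qsKnitOfRecord`)
  (𝔮 : ∀ x : MemberY θ.d₆ θ.ℓ₆ θ.hd' θ.hL' θ.b₀ θ.b₁ Mstar, QLetterY (Matrix (Fin N) (Fin N) ℂ) x.toKIdx)
  (𝔮s : ∀ x : MemberY θ.d₆ θ.ℓ₆ θ.hd' θ.hL' θ.b₀ θ.b₁ Mstar, QsLetterY (Matrix (Fin N) (Fin N) ℂ) x.toKIdx)
  (h𝔮 : ∀ (x : MemberY θ.d₆ θ.ℓ₆ θ.hd' θ.hL' θ.b₀ θ.b₁ Mstar) (U : CfgY (Matrix (Fin N) (Fin N) ℂ) x.toKIdx), 𝔮 x U = QknitY x.toKIdx U)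
  (h𝔮s : ∀ (x : MemberY θ.d₆ θ.ℓ₆ θ.hd' θ.hL' θ.b₀ θ.b₁ Mstar) (U : CfgY (Matrix (Fin N) (Fin N) ℂ) x.toKIdx), 𝔮s x U = adjTrY (QknitY x.toKIdx U))
  (hadj : ∀ (x : MemberY θ.d₆ θ.ℓ₆ θ.hd' θ.hL' θ.b₀ θ.b₁ Mstar) (α₀ : ℝ) (U : (bg9YR (Matrix (Fin N) (Fin N) ℂ) (specialUnitaryUnits (Fin N)) R₁ R₂ x).Cfg),
    (bg9YR (Matrix (Fin N) (Fin N) ℂ) (specialUnitaryUnits (Fin N)) R₁ R₂ x).Reg335 c35 α₀ U → IsAdjTr (fun _ => (1 : ℝ)) (fun _ => (1 : ℝ)) (𝔮 x U) (𝔮s x U))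
  -- the regime bridge to the member's local class and the x-free knit numerics
  {c₀ : ℝ} (hc : c₀ ≤ 10)
  (hRP : ∀ (x : MemberY θ.d₆ θ.ℓ₆ θ.hd' θ.hL' θ.b₀ θ.b₁ Mstar) (α₀ : ℝ) (U : (bg9YR (Matrix (Fin N) (Fin N) ℂ) (specialUnitaryUnits (Fin N)) R₁ R₂ x).Cfg),
    (bg9YR (Matrix (Fin N) (Fin N) ℂ) (specialUnitaryUnits (Fin N)) R₁ R₂ x).Reg335 c35 α₀ U →
      (bg9KP (Matrix (Fin N) (Fin N) ℂ) (specialUnitaryUnits (Fin N)) x.toKIdx).Reg335 c₀ α₀ U)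
  {α₀' : ℝ} (hα' : 0 < α₀') (hαQ : α₀' ≤ alphaQ (θ.d₆ + 1) (θ.ℓ₆ + 1)) {aK : ℝ} (haK : 0 < aK)
  (hKpl : ∀ (x : MemberY θ.d₆ θ.ℓ₆ θ.hd' θ.hL' θ.b₀ θ.b₁ Mstar) (a : ℝ), 0 ≤ a → a ≤ aK → Kpl x.toKIdx a * (kGeo x.toKIdx).L ^ 4 < α₀')
  -- the coordinate pins of the walk record and the block geometry
  {bI : ∀ x : MemberY θ.d₆ θ.ℓ₆ θ.hd' θ.hL' θ.b₀ θ.b₁ Mstar, FBondY x.toKIdx → IBondY x.toKIdx} (hblk : ∀ x, (𝔬 x).blk = blkBK x.toKIdx (bI x))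
  (hGco : ∀ (x : MemberY θ.d₆ θ.ℓ₆ θ.hd' θ.hL' θ.b₀ θ.b₁ Mstar) (U : (bg9YR (Matrix (Fin N) (Fin N) ℂ) (specialUnitaryUnits (Fin N)) R₁ R₂ x).Cfg), (𝔬 x).G U = GcoK x.toKIdx bK (bg9YR (Matrix (Fin N) (Fin N) ℂ) (specialUnitaryUnits (Fin N)) R₁ R₂ x) (fun U => U) (T x) U)
  (hG1co : ∀ (x : MemberY θ.d₆ θ.ℓ₆ θ.hd' θ.hL' θ.b₀ θ.b₁ Mstar) (U : (bg9YR (Matrix (Fin N) (Fin N) ℂ) (specialUnitaryUnits (Fin N)) R₁ R₂ x).Cfg), (𝔬 x).G1 U = GcoK x.toKIdx bK (bg9YR (Matrix (Fin N) (Fin N) ℂ) (specialUnitaryUnits (Fin N)) R₁ R₂ x) (fun U => U) (T₁ x) U)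
  (hG0co : ∀ (x : MemberY θ.d₆ θ.ℓ₆ θ.hd' θ.hL' θ.b₀ θ.b₁ Mstar) (U : (bg9YR (Matrix (Fin N) (Fin N) ℂ) (specialUnitaryUnits (Fin N)) R₁ R₂ x).Cfg), (𝔬 x).G0 U = GcoK x.toKIdx bK (bg9YR (Matrix (Fin N) (Fin N) ℂ) (specialUnitaryUnits (Fin N)) R₁ R₂ x) (fun U => U) (T₀ x) U)
  (hlev : ∀ (x : MemberY θ.d₆ θ.ℓ₆ θ.hd' θ.hL' θ.b₀ θ.b₁ Mstar) (f : FBondY x.toKIdx), lvl x.hN x.D x.hk (bI x f) = (blkV1 x.hN x.D f).1.1)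
  (hβ1 : ∀ (x : MemberY θ.d₆ θ.ℓ₆ θ.hd' θ.hL' θ.b₀ θ.b₁ Mstar) (f : FBondY x.toKIdx), (B6Geom246MultiLevelTorus.geomT x.D).dist (β x.hN x.D x.hk (bI x f)) (blkV1 x.hN x.D f) ≤ 1)
  {mN : ℕ} (hnbr : ∀ (x : MemberY θ.d₆ θ.ℓ₆ θ.hd' θ.hL' θ.b₀ θ.b₁ Mstar) (y : (geo9Y x).Site), (nbr (geo9Y x) ((θ.ℓ₆ : ℝ) + 4) y).card ≤ mN)
  (𝔖 : ∀ x : MemberY θ.d₆ θ.ℓ₆ θ.hd' θ.hL' θ.b₀ θ.b₁ Mstar, (bg9YR (Matrix (Fin N) (Fin N) ℂ) (specialUnitaryUnits (Fin N)) R₁ R₂ x).Cfg → BlockNorm (toB6 (geo9Y x) 1 (H₀ x)) (XBK κ x.toKIdx → ℝ))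
  (θS A₀ CR κS δK δP σ δ a₁ M₁ : ℝ) (hθS : 0 ≤ θS) (hA₀ : 0 ≤ A₀) (hCR : 0 ≤ CR) (hκS : 0 ≤ κS) (hσ : 0 < σ) (hδ : 0 < δ) (hδK : δ + 2 * σ ≤ δK) (hδP : δ + σ ≤ δP)
  (ha₁ : 0 < a₁) (hM₁ : 0 < M₁) (hgeo : ∀ x : MemberY θ.d₆ θ.ℓ₆ θ.hd' θ.hL' θ.b₀ θ.b₁ Mstar, GeoOK (geo9Y x))
  -- ROW 17 at the knit pair, DISPLAYED (KA's `hΔAK` species): symmetry AND positivity of `Δ x U`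
  (a311 M311 : ℝ) (ha311 : 0 < a311) (hM311 : 0 < M311)
  (hΔ : ∀ j : J, M311 ≤ (geo9Y (f j)).M → ∀ α₀ : ℝ, 0 < α₀ → (geo9Y (f j)).M * α₀ ≤ a311 →
    ∀ U : (bg9YR (Matrix (Fin N) (Fin N) ℂ) (specialUnitaryUnits (Fin N)) R₁ R₂ (f j)).Cfg,
      (bg9YR (Matrix (Fin N) (Fin N) ℂ) (specialUnitaryUnits (Fin N)) R₁ R₂ (f j)).Reg335 c35 α₀ U → IsSymmTr (fun _ => (1 : ℝ)) (Δ (f j) U) ∧ PosDefTr (fun _ => (1 : ℝ)) (Δ (f j) U))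
  -- the knit test family with (P′2)ᴷ ∕ (P′1)ᴷ, DISPLAYED (the genuine remainder of the road)
  (Tt : ∀ x : MemberY θ.d₆ θ.ℓ₆ θ.hd' θ.hL' θ.b₀ θ.b₁ Mstar, CfgY (Matrix (Fin N) (Fin N) ℂ) x.toKIdx →
    (IBondY x.toKIdx → Matrix (Fin N) (Fin N) ℂ) → (FBondY x.toKIdx → Matrix (Fin N) (Fin N) ℂ))
  (hTt : ∃ Mt aT ϑ C : ℝ, 0 < Mt ∧ 0 < aT ∧ ϑ < 1 ∧ 0 < C ∧
    ∀ x : MemberY θ.d₆ θ.ℓ₆ θ.hd' θ.hL' θ.b₀ θ.b₁ Mstar, Mt ≤ (geo9Y x).M → ∀ α₀ : ℝ, 0 < α₀ → (geo9Y x).M * α₀ ≤ aT →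
      ∀ U : (bg9YR (Matrix (Fin N) (Fin N) ℂ) (specialUnitaryUnits (Fin N)) R₁ R₂ x).Cfg,
        (bg9YR (Matrix (Fin N) (Fin N) ℂ) (specialUnitaryUnits (Fin N)) R₁ R₂ x).Reg335 c35 α₀ U →
        (bg9YR (Matrix (Fin N) (Fin N) ℂ) (specialUnitaryUnits (Fin N)) R₁ R₂ x).Reg336 c35 α₀ U →
          (∀ Ψ : IBondY x.toKIdx → Matrix (Fin N) (Fin N) ℂ,
            (1 - ϑ) * trIP (fun _ => (1 : ℝ)) Ψ Ψ ≤ trIP (fun _ => (1 : ℝ)) (𝔮 x U (Tt x U Ψ)) (fun y => lamInvY x.toKIdx y • Ψ y)) ∧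
          (∀ Ψ : IBondY x.toKIdx → Matrix (Fin N) (Fin N) ℂ,
            trIP (fun _ => (1 : ℝ)) (Tt x U Ψ) (Δ x U (Tt x U Ψ)) ≤ C * trIP (fun _ => (1 : ℝ)) Ψ Ψ))

include hblk hGco hG1co hG0co hθS hA₀ hCR hκS hσ hδ hδK hδP ha₁ hM₁ hlev hβ1 hnbr h𝔮 h𝔮s hc hRP hα' hαQ haK hKpl in
/-- ★ **ROW 26's TWO DECAY BINDERS AT THE KNIT PAIR FROM THE STATE TUPLE** (`majorants4_of_stepS_R` + piece 2 twice).
[cite: Balaban1985BackgroundPropagators, (3.132) p.422, Thm 3.12 pp.421–423, (3.115) p.418, (3.35)–(3.36) p.396; Balaban1984PropagatorsII, (2.142) p.248, (2.51) p.232, Lemma 2.1 (2.60)–(2.61) p.234] -/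
theorem hdec26_of_stepS_knit_R_J
    (hstate : ∀ j : J, M₁ ≤ (geo9Y (f j)).M → ∀ α₀ : ℝ, 0 < α₀ → (geo9Y (f j)).M * α₀ ≤ a₁ →
    ∀ U : (bg9YR (Matrix (Fin N) (Fin N) ℂ) (specialUnitaryUnits (Fin N)) R₁ R₂ (f j)).Cfg,
      (bg9YR (Matrix (Fin N) (Fin N) ℂ) (specialUnitaryUnits (Fin N)) R₁ R₂ (f j)).Reg335 c35 α₀ U → (bg9YR (Matrix (Fin N) (Fin N) ℂ) (specialUnitaryUnits (Fin N)) R₁ R₂ (f j)).Reg336 c35 α₀ U →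
        StepS (𝔬 (f j)) (𝔖 (f j) U) (θS * ((geo9Y (f j)).M * α₀)) δK U ∧
        HasMaj (cNorm 1 (H₀ (f j)) (𝔬 (f j)).blk (hgeo (f j)).lenle 0) (𝔖 (f j) U) ((𝔬 (f j)).G0 U) (fun a b => A₀ * Real.exp (-(δP * (geo9Y (f j)).dist a b))) ∧
        HasMaj (𝔖 (f j) U) (cNormR 1 (H₀ (f j)) (𝔬 (f j)).blk (hgeo (f j)).lenle (-2)) LinearMap.id (fun a b => CR * Real.exp (-(δP * (geo9Y (f j)).dist a b))) ∧
        (𝔖 (f j) U).κ ≤ κS ∧ (∃ Λ : ℝ, 0 ≤ Λ ∧ ∀ (y : (geo9Y (f j)).Site) (F : XBK κ (f j).toKIdx → ℝ), (𝔖 (f j) U).loc y F ≤ Λ * ∑ q : XBK κ (f j).toKIdx, |F q|) ∧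
        Identities (𝔬 (f j)) U) :
    DecayUnder c35 (fun j : J => geoComap (geo9Y (f j)) (Prod.fst : (geo9Y (f j)).Site × TrIdx N → (geo9Y (f j)).Site))
        (fun j : J => bg9YR (Matrix (Fin N) (Fin N) ℂ) (specialUnitaryUnits (Fin N)) R₁ R₂ (f j))
        (fun j U => normMatY (trBasis N) (lamInvY (f j).toKIdx) (QGQOfQY (f j).toKIdx (𝔮 (f j)) (𝔮s (f j)) (T (f j)) U)) ∧
      DecayUnder c35 (fun j : J => geoComap (geo9Y (f j)) (Prod.fst : (geo9Y (f j)).Site × TrIdx N → (geo9Y (f j)).Site))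
        (fun j : J => bg9YR (Matrix (Fin N) (Fin N) ℂ) (specialUnitaryUnits (Fin N)) R₁ R₂ (f j))
        (fun j U => normMatY (trBasis N) (lamInvY (f j).toKIdx) (QGQOfQY (f j).toKIdx (𝔮 (f j)) (𝔮s (f j)) (T₁ (f j)) U)) := by
  obtain ⟨M₂, a₂, C₁, C₂, hM₂, ha₂, hC₁, -, hmaj⟩ := B9Eq3132FromStateRJ.majorants4_of_stepS_R_J R₁ R₂ (G := specialUnitaryUnits (Fin N)) bK 𝔬 H₀ f T T₁ T₀ hblk hGco hG1co hG0co 𝔖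
    θS A₀ CR κS δK δP σ δ a₁ M₁ hθS hA₀ hCR hκS hσ hδ hδK hδP ha₁ hM₁ hgeo hstate
  exact ⟨N06Eq3132DecayFromMajorantKnitQJ.decayUnder_QGQOfQY_knit_of_majorants_R_J (f := f) R₁ R₂ specialUnitaryUnits_le_unitaryUnits bK (trBasis N) T 𝔮 𝔮s h𝔮 h𝔮s hc hRP hα' hαQ haK hKpl hlev hβ1 hnbr
      (R := fun _ => 1) ⟨M₂, a₂, C₁, δ, hM₂, ha₂, hC₁, hδ, fun j hM α₀ hα₀ hMa U hU hU' => (hmaj j hM α₀ hα₀ hMa U hU hU').1⟩,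
    N06Eq3132DecayFromMajorantKnitQJ.decayUnder_QGQOfQY_knit_of_majorants_R_J (f := f) R₁ R₂ specialUnitaryUnits_le_unitaryUnits bK (trBasis N) T₁ 𝔮 𝔮s h𝔮 h𝔮s hc hRP hα' hαQ haK hKpl hlev hβ1 hnbr
      (R := fun _ => 1) ⟨M₂, a₂, C₁, δ, hM₂, ha₂, hC₁, hδ, fun j hM α₀ hα₀ hMa U hU hU' => (hmaj j hM α₀ hα₀ hMa U hU hU').2.1⟩⟩

include hblk hGco hG1co hG0co hθS hA₀ hCR hκS hσ hδ hδK hδP ha₁ hM₁ hlev hβ1 hnbr h𝔮 h𝔮s hc hRP hα' hαQ haK hKpl hT₀ hadj ha311 hM311 hΔ hTt in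
/-- ★★ **ROW 26's TWO COERCIVITY BINDERS AT THE KNIT PAIR FROM ROW 17 (displayed at `Δ_a^Q`), A TEST FAMILY AND THE STATE TUPLE** (piece 3 + `majorants4_of_stepS_R` + piece 4 twice).
[cite: Balaban1985BackgroundPropagators, (3.132) p.422, Thm 3.12 pp.421–423, Thm 3.11 p.416, (3.115) p.418, (3.35)–(3.36) p.396; Balaban1984PropagatorsII, (2.147) p.248] -/
theorem hco26_of_stepS_knit_R_J
    (hstate : ∀ j : J, M₁ ≤ (geo9Y (f j)).M → ∀ α₀ : ℝ, 0 < α₀ → (geo9Y (f j)).M * α₀ ≤ a₁ →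
    ∀ U : (bg9YR (Matrix (Fin N) (Fin N) ℂ) (specialUnitaryUnits (Fin N)) R₁ R₂ (f j)).Cfg,
      (bg9YR (Matrix (Fin N) (Fin N) ℂ) (specialUnitaryUnits (Fin N)) R₁ R₂ (f j)).Reg335 c35 α₀ U → (bg9YR (Matrix (Fin N) (Fin N) ℂ) (specialUnitaryUnits (Fin N)) R₁ R₂ (f j)).Reg336 c35 α₀ U →
        StepS (𝔬 (f j)) (𝔖 (f j) U) (θS * ((geo9Y (f j)).M * α₀)) δK U ∧
        HasMaj (cNorm 1 (H₀ (f j)) (𝔬 (f j)).blk (hgeo (f j)).lenle 0) (𝔖 (f j) U) ((𝔬 (f j)).G0 U) (fun a b => A₀ * Real.exp (-(δP * (geo9Y (f j)).dist a b))) ∧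
        HasMaj (𝔖 (f j) U) (cNormR 1 (H₀ (f j)) (𝔬 (f j)).blk (hgeo (f j)).lenle (-2)) LinearMap.id (fun a b => CR * Real.exp (-(δP * (geo9Y (f j)).dist a b))) ∧
        (𝔖 (f j) U).κ ≤ κS ∧ (∃ Λ : ℝ, 0 ≤ Λ ∧ ∀ (y : (geo9Y (f j)).Site) (F : XBK κ (f j).toKIdx → ℝ), (𝔖 (f j) U).loc y F ≤ Λ * ∑ q : XBK κ (f j).toKIdx, |F q|) ∧
        Identities (𝔬 (f j)) U) :
    CoerciveUnder c35 (fun j : J => geoComap (geo9Y (f j)) (Prod.fst : (geo9Y (f j)).Site × TrIdx N → (geo9Y (f j)).Site))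
        (fun j : J => bg9YR (Matrix (Fin N) (Fin N) ℂ) (specialUnitaryUnits (Fin N)) R₁ R₂ (f j))
        (fun j U => normMatY (trBasis N) (lamInvY (f j).toKIdx) (QGQOfQY (f j).toKIdx (𝔮 (f j)) (𝔮s (f j)) (T (f j)) U)) ∧
      CoerciveUnder c35 (fun j : J => geoComap (geo9Y (f j)) (Prod.fst : (geo9Y (f j)).Site × TrIdx N → (geo9Y (f j)).Site))
        (fun j : J => bg9YR (Matrix (Fin N) (Fin N) ℂ) (specialUnitaryUnits (Fin N)) R₁ R₂ (f j))
        (fun j U => normMatY (trBasis N) (lamInvY (f j).toKIdx) (QGQOfQY (f j).toKIdx (𝔮 (f j)) (𝔮s (f j)) (T₁ (f j)) U)) := by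
  have hcoA := N06Eq3132CoerciveVariationalQJ.hcoA_of_testFamily_QR_J (f := f) Mstar R₁ R₂ (G := specialUnitaryUnits (Fin N)) 𝔮 𝔮s Δ T₀ hT₀ hadj a311 M311 ha311 hM311 hΔ Tt hTt
  obtain ⟨M₂, a₂, C₁, C₂, hM₂, ha₂, -, hC₂, hmaj⟩ := B9Eq3132FromStateRJ.majorants4_of_stepS_R_J R₁ R₂ (G := specialUnitaryUnits (Fin N)) bK 𝔬 H₀ f T T₁ T₀ hblk hGco hG1co hG0co 𝔖
    θS A₀ CR κS δK δP σ δ a₁ M₁ hθS hA₀ hCR hκS hσ hδ hδK hδP ha₁ hM₁ hgeo hstate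
  exact ⟨N06Eq3132CoerciveFromGAKnitQJ.coerciveUnder_of_subMajorants_knit_R_J (f := f) R₁ R₂ specialUnitaryUnits_le_unitaryUnits bK (trBasis N) T T₀ 𝔮 𝔮s h𝔮 h𝔮s hc hRP hα' hαQ haK hKpl hlev hβ1 hnbr
      (R := fun _ => 1) hcoA ⟨M₂, a₂, C₂, δ, hM₂, ha₂, hC₂, hδ, fun j hM α₀ hα₀ hMa U hU hU' => (hmaj j hM α₀ hα₀ hMa U hU hU').2.2.1⟩,
    N06Eq3132CoerciveFromGAKnitQJ.coerciveUnder_of_subMajorants_knit_R_J (f := f) R₁ R₂ specialUnitaryUnits_le_unitaryUnits bK (trBasis N) T₁ T₀ 𝔮 𝔮s h𝔮 h𝔮s hc hRP hα' hαQ haK hKpl hlev hβ1 hnbr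
      (R := fun _ => 1) hcoA ⟨M₂, a₂, C₂, δ, hM₂, ha₂, hC₂, hδ, fun j hM α₀ hα₀ hMa U hU hU' => (hmaj j hM α₀ hα₀ hMa U hU hU').2.2.2⟩⟩

include hblk hGco hG1co hG0co hθS hA₀ hCR hκS hσ hδ hδK hδP ha₁ hM₁ hlev hβ1 hnbr h𝔮 h𝔮s hc hRP hα' hαQ haK hKpl hT₀ hadj ha311 hM311 hΔ hTt in
/-- ★★★ **ROW 26 AT THE KNIT PAIR FROM THE STATE TUPLE, ROW 17 (at `Δ_a^Q`) AND A TEST FAMILY, FOR THE `ν`-READINGS OF THE TWO RING INVERSES** `(Q G_D Q⋆)⁻¹ = Ring.inverse (𝔮 T 𝔮⋆)`,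
`(Q G₁ Q⋆)⁻¹ = Ring.inverse (𝔮 T₁ 𝔮⋆)`: `B9.Stmt3132Printed (d+1) c35 geo9Y (bg9YR … R₁ R₂)` — the object-level reading (`siteKernelR R₁ R₂ (INST x).QGQinv = …`) is the certificate's pin.
[cite: Balaban1985BackgroundPropagators, (3.132) p.422, Thm 3.12 pp.421–423, Thm 3.11 p.416, (3.115) p.418, (3.35)–(3.36) p.396; Balaban1984PropagatorsII, (2.142) (2.147) p.248, Prop. 2.7 (2.149) p.249] -/
theorem s3132_nu_knit_of_stepS_R_J
    (hstate : ∀ j : J, M₁ ≤ (geo9Y (f j)).M → ∀ α₀ : ℝ, 0 < α₀ → (geo9Y (f j)).M * α₀ ≤ a₁ →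
    ∀ U : (bg9YR (Matrix (Fin N) (Fin N) ℂ) (specialUnitaryUnits (Fin N)) R₁ R₂ (f j)).Cfg,
      (bg9YR (Matrix (Fin N) (Fin N) ℂ) (specialUnitaryUnits (Fin N)) R₁ R₂ (f j)).Reg335 c35 α₀ U → (bg9YR (Matrix (Fin N) (Fin N) ℂ) (specialUnitaryUnits (Fin N)) R₁ R₂ (f j)).Reg336 c35 α₀ U →
        StepS (𝔬 (f j)) (𝔖 (f j) U) (θS * ((geo9Y (f j)).M * α₀)) δK U ∧
        HasMaj (cNorm 1 (H₀ (f j)) (𝔬 (f j)).blk (hgeo (f j)).lenle 0) (𝔖 (f j) U) ((𝔬 (f j)).G0 U) (fun a b => A₀ * Real.exp (-(δP * (geo9Y (f j)).dist a b))) ∧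
        HasMaj (𝔖 (f j) U) (cNormR 1 (H₀ (f j)) (𝔬 (f j)).blk (hgeo (f j)).lenle (-2)) LinearMap.id (fun a b => CR * Real.exp (-(δP * (geo9Y (f j)).dist a b))) ∧
        (𝔖 (f j) U).κ ≤ κS ∧ (∃ Λ : ℝ, 0 ≤ Λ ∧ ∀ (y : (geo9Y (f j)).Site) (F : XBK κ (f j).toKIdx → ℝ), (𝔖 (f j) U).loc y F ≤ Λ * ∑ q : XBK κ (f j).toKIdx, |F q|) ∧
        Identities (𝔬 (f j)) U) :
    B9.Stmt3132Printed (θ.d₆ + 1) c35 (fun j : J => geo9Y (f j))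
      (fun j : J => bg9YR (Matrix (Fin N) (Fin N) ℂ) (specialUnitaryUnits (Fin N)) R₁ R₂ (f j))
      (fun j => siteKernelOfOpNu (f j).toKIdx (bg9YR (Matrix (Fin N) (Fin N) ℂ) (specialUnitaryUnits (Fin N)) R₁ R₂ (f j)) (fun U => U) (nuY (θ.d₆ + 1) (f j).toKIdx)
        (fun U => Ring.inverse (QGQOfQY (f j).toKIdx (𝔮 (f j)) (𝔮s (f j)) (T (f j)) U)))
      (fun j => siteKernelOfOpNu (f j).toKIdx (bg9YR (Matrix (Fin N) (Fin N) ℂ) (specialUnitaryUnits (Fin N)) R₁ R₂ (f j)) (fun U => U) (nuY (θ.d₆ + 1) (f j).toKIdx)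
        (fun U => Ring.inverse (QGQOfQY (f j).toKIdx (𝔮 (f j)) (𝔮s (f j)) (T₁ (f j)) U))) := by
  obtain ⟨hdec, hdec₁⟩ := hdec26_of_stepS_knit_R_J θ Mstar R₁ R₂ bK 𝔬 H₀ f T T₁ T₀ 𝔮 𝔮s h𝔮 h𝔮s hc hRP hα' hαQ haK hKpl hblk hGco hG1co hG0co hlev hβ1 hnbr 𝔖
    θS A₀ CR κS δK δP σ δ a₁ M₁ hθS hA₀ hCR hκS hσ hδ hδK hδP ha₁ hM₁ hgeo hstate
  obtain ⟨hco, hco₁⟩ := hco26_of_stepS_knit_R_J θ Mstar R₁ R₂ bK 𝔬 H₀ f T T₁ T₀ Δ hT₀ 𝔮 𝔮s h𝔮 h𝔮s hadj hc hRP hα' hαQ haK hKpl hblk hGco hG1co hG0co hlev hβ1 hnbr 𝔖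
    θS A₀ CR κS δK δP σ δ a₁ M₁ hθS hA₀ hCR hκS hσ hδ hδK hδP ha₁ hM₁ hgeo a311 M311 ha311 hM311 hΔ Tt hTt hstate
  exact B9Eq3132NuReadingRJ.stmt3132Printed_nu_of_coercive_decay_R_J (specialUnitaryUnits (Fin N)) R₁ R₂ (f := f) (trBasis N) (θ.d₆ + 1)
    (fun x U => QGQOfQY x.toKIdx (𝔮 x) (𝔮s x) (T x) U) (fun x U => QGQOfQY x.toKIdx (𝔮 x) (𝔮s x) (T₁ x) U) hco hdec hco₁ hdec₁

end Faces

end Summit.QuantumFields.YangMills.BalabanUVNodes.N06Eq3132FromStateKnitQJ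

end
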